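import Literature.RepresentationTheory.FiniteGroups.GL2ModularPrincipalSeriesLatticeSocle
import Literature.RepresentationTheory.SubrepresentationResScalarsAsModule
import HarnessLib

/-!
# The socle of `L₀/ϖL₀` over the group ring IS `Sym^r(k²) ⊗ (χ̄₁ ∘ det)`: the recognition isomorphism

Topic `Literature/RepresentationTheory/FiniteGroups`, namespace `Literature.RepresentationTheory.FiniteGroups.GL2`.
DEFINITIONS + API (reviewed kind); no named fact, no instance, no notation, no `sorry`.

The lattice theorem for the tame principal-series type (`GL2ModularPrincipalSeriesLatticeUnique`) asks of a
lattice `Λ` that every nonzero `R[GL₂(𝔽_p)]`-submodule of `Λ/ϖΛ` receive an injection from the SOCLE SUBMODULE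
`modelSocle` of `L₀/ϖL₀`.  A consumer knows the simple constituents of its own `Λ/ϖΛ` as the Serre weight
`Sym^r(k²) ⊗ det^b` [EmertonGeeSavitt2015, §3.2: the constituent `σ̄_∅(χ) = Sym^r ⊗ χ₁∘det` of the reduction of
the type `σ(χ) = Ind(χ₁ ⊗ χ₂)`]; this file identifies the two:

* `symPowTwistEquivSubrep` — the explicit equivalence `Sym^r ⊗ ψ₁∘det ≃ Φ(Sym^r) ⊂ 𝓑(ψ₁, ψ₂)` (the tree's
  `nonempty_equiv_symPowTwist_symPowSubrep` gives existence only);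
* `map_modelSocle` — the dictionary maps `modelSocle` onto the group-ring submodule attached to the coordinate image
  of `Sym^r ⊗ χ̄₁∘det`;
* **`modelSocleEquiv : (Sym^r ⊗ χ̄₁∘det)|_R .asModule ≃ₗ[R[GL₂(𝔽_p)]] ↥modelSocle`** and its value lemma
  `bruhatLift_modelSocleEquiv` (the class attached to a binary form `φ` reduces to `Φ(φ)`).
-/

noncomputable section

namespace Literature.RepresentationTheory.FiniteGroups

namespace GL2

open Function Pointwise
open Literature.NumberTheory.Automorphic (TwistedQuotient.resScalars TwistedQuotient.resScalars_apply)

section SocleModel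

variable (p : ℕ) [Fact p.Prime] {R : Type} [CommRing R] {k : Type} [Field k] [CharP k p] [Algebra R k]
  (χ₁ χ₂ : (ZMod p)ˣ →* Rˣ) {V₀ : Type} [AddCommGroup V₀] [Module R V₀]
  {ρ₀ : Representation R (GL (Fin 2) (ZMod p)) V₀} (e₀ : ρ₀.Equiv (principalSeriesRep (ZMod p) χ₁ χ₂)) {r : ℕ}

omit [CharP k p] in
/-- The explicit equivalence `Sym^r ⊗ (ψ₁∘det) ≃ (the socle subrepresentation of 𝓑(ψ₁, ψ₂))` given by `Φ`
(the tree's `nonempty_equiv_symPowTwist_symPowSubrep` asserts its existence). [cite: EmertonGeeSavitt2015, §3.2] -/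
def symPowTwistEquivSubrep {ψ₁ ψ₂ : (ZMod p)ˣ →* kˣ}
    (hψ : ∀ a : (ZMod p)ˣ, (ψ₂ a : k) = (ψ₁ a : k) * ZMod.castHom (dvd_refl p) k a ^ r) (hr : r < p) :
    (symPowTwist (ZMod.castHom (dvd_refl p) k) ψ₁ r).Equiv
      (symPowSubrep (ZMod.castHom (dvd_refl p) k) ψ₁ ψ₂ r hψ).toRepresentation :=
  Representation.Equiv.mk
    (LinearEquiv.ofInjective _ (symPowToPrincipalSeries_injective hψ (by rwa [ZMod.card])))
    fun h => LinearMap.ext fun φ => Subtype.ext (by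
      change symPowToPrincipalSeries _ ψ₁ ψ₂ r hψ (symPowTwist _ ψ₁ r h φ) =
        principalSeriesRep (ZMod p) ψ₁ ψ₂ h (symPowToPrincipalSeries _ ψ₁ ψ₂ r hψ φ)
      rw [symPowTwist_apply, symPowToPrincipalSeries_symPowGL])

/-- The dictionary carries the socle submodule of `L₀/ϖL₀` onto the group-ring submodule attached to the
coordinate image of `Sym^r ⊗ χ̄₁∘det`. [cite: EmertonGeeSavitt2015, §3.2] -/
theorem map_modelSocle {ϖ : R} (hker : ∀ a : R, algebraMap R k a = 0 ↔ ϖ ∣ a)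
    (hsurj : Surjective (algebraMap R k))
    (hχ : ∀ a : (ZMod p)ˣ, (reduceChar k χ₂ a : k) = (reduceChar k χ₁ a : k) * ZMod.castHom (dvd_refl p) k a ^ r) :
    (modelSocle p χ₁ χ₂ e₀ hker hsurj hχ).map
        (modelReduceQuotEquiv χ₁ χ₂ e₀ hker hsurj : _ →ₗ[MonoidAlgebra R (GL (Fin 2) (ZMod p))] _) =
      Subrepresentation.asSubmodule
        ((subrepResScalarsOrderIso (coordRep (reduceChar k χ₁) (reduceChar k χ₂)) hsurj).symm
          (Subrepresentation.mapEquiv (coordEquiv (reduceChar k χ₁) (reduceChar k χ₂))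
            (symPowSubrep (ZMod.castHom (dvd_refl p) k) (reduceChar k χ₁) (reduceChar k χ₂) r hχ))) :=
  Submodule.map_comap_eq_of_surjective (modelReduceQuotEquiv χ₁ χ₂ e₀ hker hsurj).surjective _

/-- **Recognition of the socle module.**  The socle `S` of `L₀/ϖL₀` over the group ring `R[GL₂(𝔽_p)]` (the module
from which the lattice theorem wants injections) IS `Sym^r(k²) ⊗ (χ̄₁ ∘ det)` with `R[GL₂(𝔽_p)]` acting through
`k[GL₂(𝔽_p)]`: an explicit `R[GL₂(𝔽_p)]`-linear isomorphism. [cite: EmertonGeeSavitt2015, §3.2] -/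
def modelSocleEquiv {ϖ : R} (hker : ∀ a : R, algebraMap R k a = 0 ↔ ϖ ∣ a)
    (hsurj : Surjective (algebraMap R k))
    (hχ : ∀ a : (ZMod p)ˣ, (reduceChar k χ₂ a : k) = (reduceChar k χ₁ a : k) * ZMod.castHom (dvd_refl p) k a ^ r)
    (hr : r < p) :
    (TwistedQuotient.resScalars R (symPowTwist (ZMod.castHom (dvd_refl p) k) (reduceChar k χ₁) r)).asModule
      ≃ₗ[MonoidAlgebra R (GL (Fin 2) (ZMod p))] ↥(modelSocle p χ₁ χ₂ e₀ hker hsurj hχ) :=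
  ((((symPowTwistEquivSubrep p hχ hr).trans
        (Subrepresentation.equivMapEquiv (coordEquiv (reduceChar k χ₁) (reduceChar k χ₂)) _)).asModuleResEquiv R).trans
      (subrepAsModuleResEquiv (coordRep (reduceChar k χ₁) (reduceChar k χ₂)) hsurj _)).trans
    (((modelReduceQuotEquiv χ₁ χ₂ e₀ hker hsurj).submoduleMap (modelSocle p χ₁ χ₂ e₀ hker hsurj hχ)).trans
      (LinearEquiv.ofEq _ _ (map_modelSocle p χ₁ χ₂ e₀ hker hsurj hχ))).symm

/-- Underlying vectors of the recognition isomorphism: the class of `S ⊂ L₀/ϖL₀` attached to a binary form `φ`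
reduces, in the function model, to `Φ(φ)` (the image of `φ` under the embedding `Sym^r ⊗ χ̄₁∘det ↪ 𝓑(χ̄₁, χ̄₂)`). [cite: EmertonGeeSavitt2015, §3.2] -/
theorem bruhatLift_modelSocleEquiv {ϖ : R} (hker : ∀ a : R, algebraMap R k a = 0 ↔ ϖ ∣ a)
    (hsurj : Surjective (algebraMap R k))
    (hχ : ∀ a : (ZMod p)ˣ, (reduceChar k χ₂ a : k) = (reduceChar k χ₁ a : k) * ZMod.castHom (dvd_refl p) k a ^ r)
    (hr : r < p)
    (φ : (TwistedQuotient.resScalars R (symPowTwist (ZMod.castHom (dvd_refl p) k) (reduceChar k χ₁) r)).asModule) :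
    bruhatLift (reduceChar k χ₁) (reduceChar k χ₂)
        ((TwistedQuotient.resScalars R (coordRep (reduceChar k χ₁) (reduceChar k χ₂))).asModuleEquiv
          (modelReduceQuotEquiv χ₁ χ₂ e₀ hker hsurj
            ((modelSocleEquiv p χ₁ χ₂ e₀ hker hsurj hχ hr φ : ↥(modelSocle p χ₁ χ₂ e₀ hker hsurj hχ)) :
              (↥(⊤ : Submodule (MonoidAlgebra R (GL (Fin 2) (ZMod p))) ρ₀.asModule) ⧸
                (ϖ • (⊤ : Submodule (MonoidAlgebra R (GL (Fin 2) (ZMod p))) ρ₀.asModule)).comap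
                  (⊤ : Submodule (MonoidAlgebra R (GL (Fin 2) (ZMod p))) ρ₀.asModule).subtype)))) =
      symPowToPrincipalSeries (ZMod.castHom (dvd_refl p) k) (reduceChar k χ₁) (reduceChar k χ₂) r hχ
        ((TwistedQuotient.resScalars R
          (symPowTwist (ZMod.castHom (dvd_refl p) k) (reduceChar k χ₁) r)).asModuleEquiv φ) := by
  have hE : modelSocleEquiv p χ₁ χ₂ e₀ hker hsurj hχ hr φ =
      (((modelReduceQuotEquiv χ₁ χ₂ e₀ hker hsurj).submoduleMap (modelSocle p χ₁ χ₂ e₀ hker hsurj hχ)).trans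
        (LinearEquiv.ofEq _ _ (map_modelSocle p χ₁ χ₂ e₀ hker hsurj hχ))).symm
      ((((symPowTwistEquivSubrep p hχ hr).trans
          (Subrepresentation.equivMapEquiv (coordEquiv (reduceChar k χ₁) (reduceChar k χ₂)) _)).asModuleResEquiv R).trans
        (subrepAsModuleResEquiv (coordRep (reduceChar k χ₁) (reduceChar k χ₂)) hsurj _) φ) := rfl
  have h3 : ∀ w : ↥(modelSocle p χ₁ χ₂ e₀ hker hsurj hχ),
      modelReduceQuotEquiv χ₁ χ₂ e₀ hker hsurj (w : _) =
        (((((modelReduceQuotEquiv χ₁ χ₂ e₀ hker hsurj).submoduleMap (modelSocle p χ₁ χ₂ e₀ hker hsurj hχ)).trans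
          (LinearEquiv.ofEq _ _ (map_modelSocle p χ₁ χ₂ e₀ hker hsurj hχ))) w :
            ↥(Subrepresentation.asSubmodule
              ((subrepResScalarsOrderIso (coordRep (reduceChar k χ₁) (reduceChar k χ₂)) hsurj).symm
                (Subrepresentation.mapEquiv (coordEquiv (reduceChar k χ₁) (reduceChar k χ₂))
                  (symPowSubrep (ZMod.castHom (dvd_refl p) k) (reduceChar k χ₁) (reduceChar k χ₂) r hχ))))) :
          (TwistedQuotient.resScalars R (coordRep (reduceChar k χ₁) (reduceChar k χ₂))).asModule) := fun w => rfl
  rw [hE, h3, LinearEquiv.apply_symm_apply]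
  exact bruhatLift_bruhatEval _ _ _

end SocleModel

end GL2

end Literature.RepresentationTheory.FiniteGroups
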